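import Literature.AlgebraicGeometry.ModuliOfAbelianVarieties.SymplecticLiftOfMarking
import Literature.AlgebraicGeometry.ModuliOfAbelianVarieties.SiegelAdmissibleOfIso
import Literature.AlgebraicGeometry.AbelianSchemes.SymplecticLiftGeometricPoints
import HarnessLib

/-!
# The symplectic lift at the identity point of `ofAbelianVariety A₀`, built from a marking of `A₀` itself
# ([Lan2013PELCompactifications] Lemma 1.3.6.5; [Milne2005ShimuraVarieties] Thm. 6.11, `η = u ∘ a`)

Topic `AlgebraicGeometry/ModuliOfAbelianVarieties`; namespace
`Literature.AlgebraicGeometry.ModuliOfAbelianVarieties.SiegelAdelicMarking`.  Cell hodgecm-mathlib (D-0151), rung-0 U-DAG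
sub-row **U-a5 (Λ₁ junction)**: the glue between ★ (σ) `LevelStructureOfTorsionBasis` (p713965: the `level` FIELD of the
algebraic realisation `P_{Z,r}` of a Siegel point, from marking points), ★ (b) `SymplecticLiftOfMarking` (p706431: a
symplectic lift BUILT from a marking OF THE FIBRE) and ★ (symp) `SymplecticLiftGeometricPoints` (liftability is decided at
the identity point).  CONSUMER: `UHead.stub_Ua` — the `symplectic` FIELD of `P_{Z,r}` from data living on the complex
abelian variety `A₀` ONLY: a marking `m` of `A₀` by `[J, a]`, the pairing readings of a divisor `Θ₀` on `A₀`'s own torsion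
points (the D5 / normal-form identity — an INPUT, as in (b) and ★ (d) `SiegelAdmissibleExistence`), a level structure
whose sections read as marking points (what (σ) delivers), and one `Λ(𝒪(·))`-witness at the identity point.  THEOREMS
ONLY (no definition, no named fact, no instance, no `sorry`); books 0.  HC_CM is proved only modulo the 7 printed
citations until rung 0 closes.

* §1 `exists_symplecticLift_id_of_levelReading_along` — THE INTERNAL ROAD (with `e : A₁ ≅ A₀` a variable pinned by
  `he : e = fibreIdIso _`, so that `Θ₀.pullback e.hom` elaborates on the nose): transport `m` to the identity fibre `A₁ = A₀ ×_ℂ ℂ` along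
  `e⁻¹` (`e = fibreIdIso`, ★ `SiegelAdelicMarking.exists_of_iso`: `u₁ = e⁻¹ ∘ u`), move `hpair` along `e` (★
  `weilPairingLevel_pullback_eq`: `ē^{e^*Θ₀}(e⁻¹P, e⁻¹Q) = ē^{Θ₀}(P, Q)`), read the sections at `𝟙` through `e`
  (★ p713965 §5 `map_fibreIdIso_restrictPt_id_of_left_eq`), and apply ★ (b) on the fibre; the tower is read back on `A₀`
  through `e`: `a⁻¹ v̂ ≡ x̃/M ⟹ e(Λ_M(x)) = u(v)`;
* §2 `LevelStructure.SymplecticLift.exists_linEquiv_lift_eq` — ★ (T0) `nonempty_of_linEquiv` keeping `ζ` and `lift`;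
* §3 CLASS-LEVEL HEADS (the cell's identity-fibre convention, B-plan2 (g10) 11:56:33Z / B-p18 (g14) 11:55:54Z: the witness
  on the identity fibre is ANY `Θ₁` with `[Θ₁] = pr₁^*[Θ₀]` — no `IsDominant` seam in a statement):
  `exists_marking_symplecticLift_id_of_cechClass_eq` (∃ marking `m₁` of the fibre over `m` and a lift `Λ` for `Θ₁`
  matched to `m₁` — the data `(m, Θ, Λ)` + tower clause of ★ `IsAdmissibleAt`) and `isSymplecticLiftable_of_levelReading`
  (with ★ (symp): `φ.IsSymplecticLiftable pol δ` for every `(D, pol)` admitting a `Λ(𝒪(·))`-witness of that class at `𝟙`).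

## References
* [Lan2013PELCompactifications] K.-W. Lan, *Arithmetic compactifications of PEL-type Shimura varieties* (2013), §1.3.6
  Def. 1.3.6.2 (p. 80), Lemma 1.3.6.5 (p. 81).
* [Milne2005ShimuraVarieties] J. S. Milne, *Introduction to Shimura varieties* (2005), §6 Thm. 6.11 p. 74, §12 (63) p. 116.
* [MumfordAV1970] D. Mumford, *Abelian Varieties* (1970), §20 (property (3) of `e_n`, p. 186).
* [Deligne1971TravauxShimura] P. Deligne, *Travaux de Shimura*, Sém. Bourbaki 389 (1971), 4.12 (b) p. 149.
-/

set_option autoImplicit false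

noncomputable section

open CategoryTheory CategoryTheory.Limits AlgebraicGeometry Matrix

namespace Literature.AlgebraicGeometry.ModuliOfAbelianVarieties

open Literature.AlgebraicGeometry.Motives (AbelianVariety AlgPoints CartierDivisor)
open Literature.AlgebraicGeometry.AbelianSchemes (AbelianSchemeOver)
open Literature.AlgebraicGeometry.AbelianSchemes.AbelianSchemeOver (fibreIdIso ofAbelianVariety)

namespace SiegelAdelicMarking

variable {g : ℕ} {δ : Fin g → ℕ} {J : C0pm δ} {a : gspFinAdelic δ} {N : ℕ} {A₀ : AbelianVariety ℂ}

/-- **THE U-a5 JUNCTION: a symplectic lift of `φ(𝟙)` for `e^*Θ₀`, built from a marking of `A₀` and read through `a`.**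
Let `m` mark the complex abelian variety `A₀` by `[J, a]` (`u = m.r`), `φ` a level-`N` structure on the abelian scheme
`ofAbelianVariety A₀ → Spec ℂ` whose sections READ as marking points (`(σᵢ).left = (u vᵢ).left` as maps `Spec ℂ → A₀`, with
`a⁻¹ v̂ᵢ ≡ eᵢ/N` — the output shape of ★ `LevelStructure.exists_of_torsionBasis` fed with `xᵢ := u vᵢ`), `Θ₀` a divisor on
`A₀`, and `ζ` a compatible system of primitive roots for which the Weil pairing of `Θ₀` on points read at `x̃/M`, `ỹ/M`
through `a` is `ζ_M ^ E_δ(x, y)` (`hpair`, an INPUT).  Then, with `e : A₁ ≅ A₀` the identity-fibre isomorphism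
(★ `fibreIdIso`), there is a symplectic lift `Λ` of `φ` at `𝟙` for the witness `e^*Θ₀` with `Λ.ζ = ζ` whose whole tower is
read through `a` on `A₀`: `a⁻¹ v̂ ≡ x̃/M ⟹ e(Λ_M(x)) = u(v)`.  Proof: ★ `exists_of_iso` along `e⁻¹`, ★
`weilPairingLevel_pullback_eq` along `e`, ★ `map_fibreIdIso_restrictPt_id_of_left_eq`, ★ (b)
`exists_symplecticLift_of_levelReading`. [cite: Lan2013PELCompactifications, §1.3.6 Def. 1.3.6.2 (p. 80) and Lemma 1.3.6.5 (p. 81)]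
[cite: Milne2005ShimuraVarieties, §6 Thm. 6.11 p. 74 and §12 (63) p. 116] [cite: MumfordAV1970, §20 (property (3) of e_n, p. 186)] -/
theorem exists_symplecticLift_id_of_levelReading_along (m : SiegelAdelicMarking J a A₀)
    (φ : (ofAbelianVariety A₀).LevelStructure g N) (Θ₀ : CartierDivisor A₀.X.left)
    (e : ((ofAbelianVariety A₀).fibre (𝟙 (Spec (.of ℂ)))).toAbelianVariety ≅ A₀) (he : e = fibreIdIso (ofAbelianVariety A₀))
    (ζ : ℕ → ℂ) (hζ : ∀ ⦃M : ℕ⦄, N ∣ M → M ≠ 0 → IsPrimitiveRoot (ζ M) M)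
    (hζ_pow : ∀ ⦃M : ℕ⦄ (k : ℕ), N ∣ M → M ≠ 0 → k ≠ 0 → ζ (k * M) ^ k = ζ M)
    (hpair : ∀ ⦃M : ℕ⦄, N ∣ M → ∀ (hMΩ : (M : ℂ) ≠ 0) (x y : Fin g ⊕ Fin g → ZMod M)
      (P Q : A₀.torsionPoints ℂ (M : ℤ)),
      (∀ v, AdelicCongr ((a⁻¹ : gspFinAdelic δ) : GL (Fin g ⊕ Fin g) finAdeleQ) 1 v
          (fun i => ((x i).val : ℚ) / M) → (P : A₀.Points ℂ) = m.r v) →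
      (∀ w, AdelicCongr ((a⁻¹ : gspFinAdelic δ) : GL (Fin g ⊕ Fin g) finAdeleQ) 1 w
          (fun i => ((y i).val : ℚ) / M) → (Q : A₀.Points ℂ) = m.r w) →
      haveI := AbelianVariety.isDominant_toSchemeHom_zsmul_of_ne_zero A₀ hMΩ
      A₀.weilPairingLevel Θ₀ P Q = ζ M ^ (AbelianSchemeOver.typeFormMod δ M x y).val)
    (hlevel : ∀ i : Fin g ⊕ Fin g, ∃ v : Fin g ⊕ Fin g → ℚ,
      AdelicCongr ((a⁻¹ : gspFinAdelic δ) : GL (Fin g ⊕ Fin g) finAdeleQ) 1 v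
          (fun j => (((Pi.single i (1 : ZMod N) : Fin g ⊕ Fin g → ZMod N) j).val : ℚ) / N) ∧
        @Eq (Spec (.of ℂ) ⟶ A₀.X.left) (φ.σ i).left (m.r v).left) :
    haveI := AbelianVariety.isDominant_toSchemeHom_iso_hom e
    ∃ Λ : φ.SymplecticLift (𝟙 (Spec (.of ℂ))) (Θ₀.pullback (AbelianVariety.Hom.toSchemeHom e.hom)) δ,
      (∀ M, Λ.ζ M = ζ M) ∧
      ∀ ⦃M : ℕ⦄, N ∣ M → M ≠ 0 → ∀ (x : Fin g ⊕ Fin g → ZMod M) (v : Fin g ⊕ Fin g → ℚ),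
        AdelicCongr ((a⁻¹ : gspFinAdelic δ) : GL (Fin g ⊕ Fin g) finAdeleQ) 1 v (fun i => ((x i).val : ℚ) / M) →
          AlgPoints.map e.hom.hom.hom.hom
            ((Λ.lift M (Multiplicative.ofAdd x)) :
              ((ofAbelianVariety A₀).fibre (𝟙 (Spec (.of ℂ)))).toAbelianVariety.Points ℂ) = m.r v := by
  classical
  haveI := AbelianVariety.isDominant_toSchemeHom_iso_hom e
  -- the identity fibre `A₁`; `e = fibreIdIso : A₁ ≅ A₀`
  let A₁ := ((ofAbelianVariety A₀).fibre (𝟙 (Spec (.of ℂ)))).toAbelianVariety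
  have hinv : ∀ P : A₁.Points ℂ, AlgPoints.map e.inv.hom.hom.hom (AlgPoints.map e.hom.hom.hom.hom P) = P := by
    subst he; exact (ofAbelianVariety A₀).map_fibreIdIso_inv_map_hom
  have hhom : ∀ Q : A₀.Points ℂ, AlgPoints.map e.hom.hom.hom.hom (AlgPoints.map e.inv.hom.hom.hom Q) = Q := by
    subst he; exact (ofAbelianVariety A₀).map_fibreIdIso_hom_map_inv
  -- the sections read at `𝟙` through `e` (★ p713965 §5)
  have hread₁ : ∀ (σ : (ofAbelianVariety A₀).Sections) (P : A₀.Points ℂ), @Eq (Spec (.of ℂ) ⟶ A₀.X.left) σ.left P.left →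
      AlgPoints.map e.hom.hom.hom.hom ((ofAbelianVariety A₀).restrictPt (𝟙 (Spec (.of ℂ))) σ) = P := by
    subst he; exact fun σ P h => AbelianSchemeOver.map_fibreIdIso_restrictPt_id_of_left_eq A₀ h
  -- the marking of the identity fibre: `u₁ = e⁻¹ ∘ u`
  obtain ⟨m₁, -, hm₁⟩ := m.exists_of_iso e.symm
  have hm₁' : ∀ v, m₁.r v = AlgPoints.map e.inv.hom.hom.hom (m.r v) := hm₁
  -- `hpair` moved to the fibre along `e`
  have hpair₁ : ∀ ⦃M : ℕ⦄, N ∣ M → ∀ (hMΩ : (M : ℂ) ≠ 0) (x y : Fin g ⊕ Fin g → ZMod M)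
      (P Q : A₁.torsionPoints ℂ (M : ℤ)),
      (∀ v, AdelicCongr ((a⁻¹ : gspFinAdelic δ) : GL (Fin g ⊕ Fin g) finAdeleQ) 1 v
          (fun i => ((x i).val : ℚ) / M) → (P : A₁.Points ℂ) = m₁.r v) →
      (∀ w, AdelicCongr ((a⁻¹ : gspFinAdelic δ) : GL (Fin g ⊕ Fin g) finAdeleQ) 1 w
          (fun i => ((y i).val : ℚ) / M) → (Q : A₁.Points ℂ) = m₁.r w) →
      haveI := AbelianVariety.isDominant_toSchemeHom_zsmul_of_ne_zero A₁ hMΩ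
      A₁.weilPairingLevel (Θ₀.pullback (AbelianVariety.Hom.toSchemeHom e.hom)) P Q =
        ζ M ^ (AbelianSchemeOver.typeFormMod δ M x y).val := by
    intro M hM hMΩ x y P Q hP hQ
    haveI := AbelianVariety.isDominant_toSchemeHom_zsmul_of_ne_zero A₁ hMΩ
    haveI := AbelianVariety.isDominant_toSchemeHom_zsmul_of_ne_zero A₀ hMΩ
    let P' : A₀.torsionPoints ℂ (M : ℤ) := ⟨AlgPoints.map e.hom.hom.hom.hom P.1, AbelianVariety.map_mem_torsionPoints _ P.2⟩
    let Q' : A₀.torsionPoints ℂ (M : ℤ) := ⟨AlgPoints.map e.hom.hom.hom.hom Q.1, AbelianVariety.map_mem_torsionPoints _ Q.2⟩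
    have hP' : ∀ v, AdelicCongr ((a⁻¹ : gspFinAdelic δ) : GL (Fin g ⊕ Fin g) finAdeleQ) 1 v
        (fun i => ((x i).val : ℚ) / M) → (P' : A₀.Points ℂ) = m.r v := fun v hv => by
      change AlgPoints.map e.hom.hom.hom.hom P.1 = m.r v
      rw [hP v hv, hm₁', hhom]
    have hQ' : ∀ w, AdelicCongr ((a⁻¹ : gspFinAdelic δ) : GL (Fin g ⊕ Fin g) finAdeleQ) 1 w
        (fun i => ((y i).val : ℚ) / M) → (Q' : A₀.Points ℂ) = m.r w := fun w hw => by
      change AlgPoints.map e.hom.hom.hom.hom Q.1 = m.r w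
      rw [hQ w hw, hm₁', hhom]
    rw [AbelianVariety.weilPairingLevel_pullback_eq e.hom Θ₀ P Q P' Q' rfl rfl]
    exact hpair hM hMΩ x y P' Q' hP' hQ'
  -- `hlevel` read at `𝟙` through `e`
  have hlevel₁ : ∀ i : Fin g ⊕ Fin g, ∃ v : Fin g ⊕ Fin g → ℚ,
      AdelicCongr ((a⁻¹ : gspFinAdelic δ) : GL (Fin g ⊕ Fin g) finAdeleQ) 1 v
          (fun j => (((Pi.single i (1 : ZMod N) : Fin g ⊕ Fin g → ZMod N) j).val : ℚ) / N) ∧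
        (ofAbelianVariety A₀).restrictPt (𝟙 (Spec (.of ℂ))) (φ.σ i) = m₁.r v := by
    intro i
    obtain ⟨v, hv, hσ⟩ := hlevel i
    refine ⟨v, hv, ?_⟩
    rw [hm₁', ← hread₁ (φ.σ i) (m.r v) hσ, hinv]
  -- ★ (b) on the fibre
  obtain ⟨Λ, hΛζ, hread⟩ :=
    exists_symplecticLift_of_levelReading φ (Θ₀.pullback (AbelianVariety.Hom.toSchemeHom e.hom)) m₁ ζ hζ hζ_pow
      hpair₁ hlevel₁
  refine ⟨Λ, hΛζ, fun M hM hM₀ x v hv => ?_⟩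
  rw [hread hM hM₀ x v hv, hm₁', hhom]

end SiegelAdelicMarking

end Literature.AlgebraicGeometry.ModuliOfAbelianVarieties

/-! ### §2 (T0 with data): a symplectic lift for `Θ` is one for every linearly equivalent `Θ′`, SAME roots and tower -/

namespace Literature.AlgebraicGeometry.AbelianSchemes.AbelianSchemeOver.LevelStructure.SymplecticLift

open Literature.AlgebraicGeometry.Motives

universe u in
/-- **(T0) keeping the data**: a symplectic lift `Λ` of `φ(s)` for `Θ` yields one for any linearly equivalent `Θ′` with
the SAME roots `ζ_M` and the SAME tower `lift_M` (only the pairing clause mentions `Θ`, and `ē^Θ_M = ē^{Θ′}_M` for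
`Θ ∼ Θ′`, ★ `weilPairingLevel_congr_linEquiv`) — the data-preserving form of ★ `SymplecticLift.nonempty_of_linEquiv`, so
that a tower-matching clause survives the change of witness. [cite: Lang1983AbelianVarieties, Ch. VII §2 Prop. 3]
[cite: Lan2013PELCompactifications, §1.3.6 Lemma 1.3.6.5 (p. 81)] -/
theorem exists_linEquiv_lift_eq {S : Scheme.{u}} {A : AbelianSchemeOver S} {g N : ℕ} {φ : A.LevelStructure g N}
    {Ω : Type u} [Field Ω] {s : Spec (.of Ω) ⟶ S} {δ : Fin g → ℕ}
    {Θ Θ' : CartierDivisor (A.fibre s).toAbelianVariety.X.left} (h : Θ.LinEquiv Θ') (Λ : φ.SymplecticLift s Θ δ) :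
    ∃ Λ' : φ.SymplecticLift s Θ' δ, (∀ M, Λ'.ζ M = Λ.ζ M) ∧ ∀ M, Λ'.lift M = Λ.lift M :=
  ⟨{ ζ := Λ.ζ
     isPrimitiveRoot_ζ := Λ.isPrimitiveRoot_ζ
     ζ_pow := Λ.ζ_pow
     lift := Λ.lift
     lift_bijective := Λ.lift_bijective
     lift_compat := Λ.lift_compat
     lift_level := Λ.lift_level
     pairing := fun M hM hMΩ x y => by
       haveI := AbelianVariety.isDominant_toSchemeHom_zsmul_of_ne_zero (A.fibre s).toAbelianVariety hMΩ
       rw [← AbelianVariety.weilPairingLevel_congr_linEquiv h]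
       exact Λ.weilPairingLevel_lift hM hMΩ x y }, fun _ => rfl, fun _ => rfl⟩

end Literature.AlgebraicGeometry.AbelianSchemes.AbelianSchemeOver.LevelStructure.SymplecticLift

/-! ### §3 The consumer-facing heads: CLASS-LEVEL witness `Θ₁` on the identity fibre (cell convention, B-plan2 (g10)
11:56:33Z / B-p18 (g14) 11:55:54Z: `Θ₁.cechClass = pr₁^*Θ₀.cechClass`, no `IsDominant` seam in any statement) -/

namespace Literature.AlgebraicGeometry.ModuliOfAbelianVarieties

open Literature.AlgebraicGeometry.Motives (AbelianVariety AlgPoints CartierDivisor)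
open Literature.AlgebraicGeometry.AbelianSchemes (AbelianSchemeOver)
open Literature.AlgebraicGeometry.AbelianSchemes.AbelianSchemeOver (fibreIdIso ofAbelianVariety)
open Literature.AlgebraicGeometry.Modules (CechPic)

namespace SiegelAdelicMarking

variable {g : ℕ} {δ : Fin g → ℕ} {J : C0pm δ} {a : gspFinAdelic δ} {N : ℕ} {A₀ : AbelianVariety ℂ}

/-- The underlying scheme map of the identity-fibre isomorphism `e` IS the projection `A₀ ×_ℂ ℂ → A₀`
(★ `fibreIdToGrpIso_hom_left`). [cite: GortzWedhorn2020, Section (4.7) (pp. 107–108)] -/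
theorem toSchemeHom_fibreIdIso_hom_eq_fst :
    AbelianVariety.Hom.toSchemeHom (fibreIdIso (ofAbelianVariety A₀)).hom =
      pullback.fst (ofAbelianVariety A₀).X.hom (𝟙 (Spec (.of ℂ))) := by
  change (fibreIdIso (ofAbelianVariety A₀)).hom.hom.hom.hom.left = _
  rw [AbelianSchemeOver.fibreIdIso_hom_hom, AbelianSchemeOver.fibreIdToGrpIso_hom_left]

/-- **THE U-a5 JUNCTION, CLASS-LEVEL (the cell's identity-fibre convention).**  For a marking `m` of `A₀` by `[J, a]`,
a level structure `φ` on `ofAbelianVariety A₀` whose sections read as marking points, a divisor `Θ₀` on `A₀` with the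
pairing readings `hpair` through `a`, and ANY divisor `Θ₁` on the identity fibre `A₁ = A₀ ×_ℂ ℂ` with
`[Θ₁] = pr₁^*[Θ₀]`: there are a marking `m₁` of `A₁` by `[J, a]` lying over `m` (`e ∘ u₁ = u`, same `γ`) and a symplectic
lift `Λ` of `φ(𝟙)` for `Θ₁` with `Λ.ζ = ζ` whose whole tower is MATCHED to `m₁`: `a⁻¹ v̂ ≡ x̃/M ⟹ Λ_M(x) = u₁(v)` —
token for token the data `(m, Θ, Λ)` and the tower clause of ★ `IsAdmissibleAt`.  (Internal road: §1 for `e^*Θ₀`, then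
`[e^*Θ₀] = e^*[Θ₀] = pr₁^*[Θ₀] = [Θ₁]` (★ `cechClass_pullback`, `toSchemeHom_fibreIdIso_hom_eq_fst`), ★
`linEquiv_of_cechClass_eq`, §2.) [cite: Lan2013PELCompactifications, §1.3.6 Def. 1.3.6.2 (p. 80) and Lemma 1.3.6.5 (p. 81)]
[cite: Milne2005ShimuraVarieties, §6 Thm. 6.11 p. 74 and §12 (63) p. 116] -/
theorem exists_marking_symplecticLift_id_of_cechClass_eq (m : SiegelAdelicMarking J a A₀)
    (φ : (ofAbelianVariety A₀).LevelStructure g N) (Θ₀ : CartierDivisor A₀.X.left)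
    (ζ : ℕ → ℂ) (hζ : ∀ ⦃M : ℕ⦄, N ∣ M → M ≠ 0 → IsPrimitiveRoot (ζ M) M)
    (hζ_pow : ∀ ⦃M : ℕ⦄ (k : ℕ), N ∣ M → M ≠ 0 → k ≠ 0 → ζ (k * M) ^ k = ζ M)
    (hpair : ∀ ⦃M : ℕ⦄, N ∣ M → ∀ (hMΩ : (M : ℂ) ≠ 0) (x y : Fin g ⊕ Fin g → ZMod M)
      (P Q : A₀.torsionPoints ℂ (M : ℤ)),
      (∀ v, AdelicCongr ((a⁻¹ : gspFinAdelic δ) : GL (Fin g ⊕ Fin g) finAdeleQ) 1 v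
          (fun i => ((x i).val : ℚ) / M) → (P : A₀.Points ℂ) = m.r v) →
      (∀ w, AdelicCongr ((a⁻¹ : gspFinAdelic δ) : GL (Fin g ⊕ Fin g) finAdeleQ) 1 w
          (fun i => ((y i).val : ℚ) / M) → (Q : A₀.Points ℂ) = m.r w) →
      haveI := AbelianVariety.isDominant_toSchemeHom_zsmul_of_ne_zero A₀ hMΩ
      A₀.weilPairingLevel Θ₀ P Q = ζ M ^ (AbelianSchemeOver.typeFormMod δ M x y).val)
    (hlevel : ∀ i : Fin g ⊕ Fin g, ∃ v : Fin g ⊕ Fin g → ℚ,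
      AdelicCongr ((a⁻¹ : gspFinAdelic δ) : GL (Fin g ⊕ Fin g) finAdeleQ) 1 v
          (fun j => (((Pi.single i (1 : ZMod N) : Fin g ⊕ Fin g → ZMod N) j).val : ℚ) / N) ∧
        @Eq (Spec (.of ℂ) ⟶ A₀.X.left) (φ.σ i).left (m.r v).left)
    (Θ₁ : CartierDivisor ((ofAbelianVariety A₀).fibre (𝟙 (Spec (.of ℂ)))).toAbelianVariety.X.left)
    (hΘ₁ : Θ₁.cechClass = CechPic.pullback (pullback.fst (ofAbelianVariety A₀).X.hom (𝟙 (Spec (.of ℂ)))) Θ₀.cechClass) :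
    ∃ (m₁ : SiegelAdelicMarking J a ((ofAbelianVariety A₀).fibre (𝟙 (Spec (.of ℂ)))).toAbelianVariety)
      (Λ : φ.SymplecticLift (𝟙 (Spec (.of ℂ))) Θ₁ δ),
      m₁.γ = m.γ ∧
      (∀ v, AlgPoints.map (fibreIdIso (ofAbelianVariety A₀)).hom.hom.hom.hom (m₁.r v) = m.r v) ∧
      (∀ M, Λ.ζ M = ζ M) ∧
      ∀ ⦃M : ℕ⦄, N ∣ M → M ≠ 0 → ∀ (x : Fin g ⊕ Fin g → ZMod M) (v : Fin g ⊕ Fin g → ℚ),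
        AdelicCongr ((a⁻¹ : gspFinAdelic δ) : GL (Fin g ⊕ Fin g) finAdeleQ) 1 v (fun i => ((x i).val : ℚ) / M) →
          ((Λ.lift M (Multiplicative.ofAdd x)) :
            ((ofAbelianVariety A₀).fibre (𝟙 (Spec (.of ℂ)))).toAbelianVariety.Points ℂ) = m₁.r v := by
  classical
  let A₁ := ((ofAbelianVariety A₀).fibre (𝟙 (Spec (.of ℂ)))).toAbelianVariety
  let e : A₁ ≅ A₀ := fibreIdIso (ofAbelianVariety A₀)
  haveI := AbelianVariety.isDominant_toSchemeHom_iso_hom e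
  have hhom : ∀ Q : A₀.Points ℂ, AlgPoints.map e.hom.hom.hom.hom (AlgPoints.map e.inv.hom.hom.hom Q) = Q :=
    (ofAbelianVariety A₀).map_fibreIdIso_hom_map_inv
  have hinj : Function.Injective fun P : A₁.Points ℂ => AlgPoints.map e.hom.hom.hom.hom P :=
    (ofAbelianVariety A₀).map_fibreIdIso_hom_injective
  -- §1 for the witness `e^*Θ₀`
  obtain ⟨Λ, hΛζ, hread⟩ := m.exists_symplecticLift_id_of_levelReading_along φ Θ₀ e rfl ζ hζ hζ_pow hpair hlevel
  -- the marking of the identity fibre lying over `m`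
  obtain ⟨m₁, hγ, hm₁⟩ := m.exists_of_iso e.symm
  have hm₁' : ∀ v, AlgPoints.map e.hom.hom.hom.hom (m₁.r v) = m.r v := fun v => by rw [hm₁]; exact hhom _
  -- `[e^*Θ₀] = e^*[Θ₀] = pr₁^*[Θ₀] = [Θ₁]`
  have hcl : (Θ₀.pullback (AbelianVariety.Hom.toSchemeHom e.hom)).cechClass = Θ₁.cechClass := by
    rw [CartierDivisor.cechClass_pullback, hΘ₁]
    exact congrArg (fun f => CechPic.pullback f Θ₀.cechClass) (toSchemeHom_fibreIdIso_hom_eq_fst (A₀ := A₀))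
  -- change of witness keeping the data (§2)
  obtain ⟨Λ', hζ', hlift'⟩ :=
    AbelianSchemeOver.LevelStructure.SymplecticLift.exists_linEquiv_lift_eq
      (CartierDivisor.linEquiv_of_cechClass_eq hcl) Λ
  refine ⟨m₁, Λ', hγ, hm₁', fun M => (hζ' M).trans (hΛζ M), fun M hM hM₀ x v hv => ?_⟩
  apply hinj
  change AlgPoints.map e.hom.hom.hom.hom _ = AlgPoints.map e.hom.hom.hom.hom _
  rw [hlift', hread hM hM₀ x v hv, hm₁']

/-- **U-a5 FOR THE CONSUMER: `P_{Z,r}.symplectic` from data on `A₀`** — with ★ (symp)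
`isSymplecticLiftable_of_identityFibre` (liftability is decided at the identity point over `ℂ = ℂ̄`): under the data of
`exists_marking_symplecticLift_id_of_cechClass_eq`, the level structure `φ` of `ofAbelianVariety A₀` is
SYMPLECTIC-LIFTABLE of type `δ` (★ D3 `IsSymplecticLiftable`, the field `PolarizedAbelianSchemeWithLevel.symplectic`) for
EVERY polarisation `pol` of EVERY dual pair `D` admitting, at the identity point, a `Λ(𝒪(·))`-witness `Θ₁` of class
`pr₁^*[Θ₀]` (the class-level export of U-a4's `𝟙`-point witness). [cite: Lan2013PELCompactifications, §1.3.6 Def. 1.3.6.2 (p. 80), Lemma 1.3.6.5 and Lemma 1.3.6.6 (pp. 81–82)]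
[cite: Deligne1971TravauxShimura, 4.12 (b) p. 149] -/
theorem isSymplecticLiftable_of_levelReading (m : SiegelAdelicMarking J a A₀)
    (φ : (ofAbelianVariety A₀).LevelStructure g N) (Θ₀ : CartierDivisor A₀.X.left)
    (ζ : ℕ → ℂ) (hζ : ∀ ⦃M : ℕ⦄, N ∣ M → M ≠ 0 → IsPrimitiveRoot (ζ M) M)
    (hζ_pow : ∀ ⦃M : ℕ⦄ (k : ℕ), N ∣ M → M ≠ 0 → k ≠ 0 → ζ (k * M) ^ k = ζ M)
    (hpair : ∀ ⦃M : ℕ⦄, N ∣ M → ∀ (hMΩ : (M : ℂ) ≠ 0) (x y : Fin g ⊕ Fin g → ZMod M)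
      (P Q : A₀.torsionPoints ℂ (M : ℤ)),
      (∀ v, AdelicCongr ((a⁻¹ : gspFinAdelic δ) : GL (Fin g ⊕ Fin g) finAdeleQ) 1 v
          (fun i => ((x i).val : ℚ) / M) → (P : A₀.Points ℂ) = m.r v) →
      (∀ w, AdelicCongr ((a⁻¹ : gspFinAdelic δ) : GL (Fin g ⊕ Fin g) finAdeleQ) 1 w
          (fun i => ((y i).val : ℚ) / M) → (Q : A₀.Points ℂ) = m.r w) →
      haveI := AbelianVariety.isDominant_toSchemeHom_zsmul_of_ne_zero A₀ hMΩ
      A₀.weilPairingLevel Θ₀ P Q = ζ M ^ (AbelianSchemeOver.typeFormMod δ M x y).val)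
    (hlevel : ∀ i : Fin g ⊕ Fin g, ∃ v : Fin g ⊕ Fin g → ℚ,
      AdelicCongr ((a⁻¹ : gspFinAdelic δ) : GL (Fin g ⊕ Fin g) finAdeleQ) 1 v
          (fun j => (((Pi.single i (1 : ZMod N) : Fin g ⊕ Fin g → ZMod N) j).val : ℚ) / N) ∧
        @Eq (Spec (.of ℂ) ⟶ A₀.X.left) (φ.σ i).left (m.r v).left)
    {D : (ofAbelianVariety A₀).DualPair} (pol : (ofAbelianVariety A₀).Polarization D)
    (Θ₁ : CartierDivisor ((ofAbelianVariety A₀).fibre (𝟙 (Spec (.of ℂ)))).toAbelianVariety.X.left)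
    (hΘ₁ : Θ₁.cechClass = CechPic.pullback (pullback.fst (ofAbelianVariety A₀).X.hom (𝟙 (Spec (.of ℂ)))) Θ₀.cechClass)
    (h₁ : (ofAbelianVariety A₀).IsLambdaOfAt (𝟙 (Spec (.of ℂ))) D pol.lam Θ₁) :
    φ.IsSymplecticLiftable pol δ := by
  obtain ⟨-, Λ, -, -, -, -⟩ :=
    m.exists_marking_symplecticLift_id_of_cechClass_eq φ Θ₀ ζ hζ hζ_pow hpair hlevel Θ₁ hΘ₁
  exact AbelianSchemeOver.LevelStructure.isSymplecticLiftable_of_identityFibre D pol h₁ ⟨Λ⟩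

end SiegelAdelicMarking

end Literature.AlgebraicGeometry.ModuliOfAbelianVarieties

end
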